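import Mathlib
import HarnessLib
import Literature.MathematicalPhysics.QuantumLattice.HubbardBondAlgebra

/-!
# Route `ThermalWedge`, crux `TwSeededEnsembleEquivalenceR` (stmt-HubbardSuperconductivity-15581):
# the atomic Gibbs factor with an ABSTRACT even local perturbation — factorisation and volume independence

Support file (`--supports stmt-HubbardSuperconductivity-15581`; no definition; the route file is NOT imported).
Infrastructure for the thermodynamic limit of the SOURCED torus pressure (registered stub
`stub_sourcedPressureLimit` of the line `Sketch`/cold-floor-collapse): Ueltschi's factorisation property and
the volume independence of the Gibbs factor `Tr exp(-β V_Λ + P)`, `V_Λ = Σ_x (U n_{x↑}n_{x↓} - μ(n_{x↑}+n_{x↓}))`,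
for an ARBITRARY even local perturbation `P` (hopping AND pair-source terms alike), i.e. the two theorems
`Zc_add_mul_Zc_zero` and `Zc_extend` of `Literature/…/HubbardBondAlgebra.lean` with the hopping operator
`hopSum c` replaced by an abstract element of the even CAR subalgebra:

* `twR_trace_exp_atomic_add_add_mul` — for `P₁ ∈ 𝔄⁺(A₁)`, `P₂ ∈ 𝔄⁺(A₂)`, `A₁ ∩ A₂ = ∅`:
  `Tr e^{-βV + P₁ + P₂} · Tr e^{-βV} = Tr e^{-βV + P₁} · Tr e^{-βV + P₂}`;
* `twR_jwEmbed_mem_carEvenSubalgebra` — second quantisation of an order embedding maps `𝔄⁺(S)` into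
  `𝔄⁺(e S)`;
* `twR_trace_exp_atomic_add_jwEmbed` — along an order embedding of site sets `e : Λ ↪o Λ'`,
  `Tr_{Λ'} e^{-βV_{Λ'} + e_* P} = Tr_Λ e^{-βV_Λ + P} · z₀^{|Λ'| - |Λ|}` for every even `P`.

Ueltschi, J. Stat. Phys. 95 (1999) 693, §2.1 (factorization property), §2.3; Bratteli–Robinson II §5.2.2.
Everything is [folklore] finite-dimensional algebra over the cited tree facts
(`trace_exp_add_add_mul`, `trace_mul_of_mem_carSubalgebra`, `commute_of_mem_carEvenSubalgebra`,
`exp_mem_subalgebra`, `trace_exp_neg_onSiteSum`, `trace_exp_jwEmbed`, `jwEmbed_onSiteSum`).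
-/

set_option linter.dupNamespace false

noncomputable section

namespace Summit.HubbardSuperconductivity.HubbardSuperconductivity.Theorems

open Literature.MathematicalPhysics.QuantumLattice Matrix Finset HubbardWave0
open scoped BigOperators

/-! ### Factorisation over disjoint supports -/

section Factorisation

variable {Λ : Type*} [LinearOrder Λ] [Fintype Λ]

/-- Cross-multiplication bookkeeping for the factorisation (copy of the private lemma of
`HubbardBondAlgebra.lean`). [folklore] -/
theorem twR_cross_mul_aux {a d b₁ b₂ x₁ x₂ y₁ y₂ τ N : ℂ} (hN : N ≠ 0) (f12 : a * N = x₁ * x₂ * τ)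
    (f0 : d * N = y₁ * y₂ * τ) (f1 : b₁ * N = x₁ * y₂ * τ) (f2 : b₂ * N = y₁ * x₂ * τ) :
    a * d = b₁ * b₂ := by
  apply mul_right_cancel₀ (mul_ne_zero hN hN)
  calc a * d * (N * N) = (a * N) * (d * N) := by ring
    _ = (x₁ * x₂ * τ) * (y₁ * y₂ * τ) := by rw [f12, f0]
    _ = (x₁ * y₂ * τ) * (y₁ * x₂ * τ) := by ring
    _ = (b₁ * N) * (b₂ * N) := by rw [f1, f2]
    _ = b₁ * b₂ * (N * N) := by ring

/-- **Factorisation of the atomic Gibbs factor with an abstract even local perturbation**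
(Ueltschi's factorization property, §2.1, in trace form): if `P₁`, `P₂` are even local operators of
disjoint site sets `A₁`, `A₂`, then
`Tr e^{-βV_Λ + P₁ + P₂} · Tr e^{-βV_Λ} = Tr e^{-βV_Λ + P₁} · Tr e^{-βV_Λ + P₂}`. [folklore] -/
theorem twR_trace_exp_atomic_add_add_mul (β U μ : ℂ) {A₁ A₂ : Finset Λ} (hA : Disjoint A₁ A₂)
    {P₁ P₂ : Matrix (Finset (Orb Λ)) (Finset (Orb Λ)) ℂ}
    (hP₁ : P₁ ∈ carEvenSubalgebra (orbs A₁)) (hP₂ : P₂ ∈ carEvenSubalgebra (orbs A₂)) :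
    (NormedSpace.exp (-(β • onSiteSum U μ (Finset.univ : Finset Λ)) + P₁ + P₂)).trace *
        (NormedSpace.exp (-(β • onSiteSum U μ (Finset.univ : Finset Λ)))).trace =
      (NormedSpace.exp (-(β • onSiteSum U μ (Finset.univ : Finset Λ)) + P₁)).trace *
        (NormedSpace.exp (-(β • onSiteSum U μ (Finset.univ : Finset Λ)) + P₂)).trace := by
  set A₃ : Finset Λ := (A₁ ∪ A₂)ᶜ with hA₃
  have h13 : Disjoint A₁ A₃ := Finset.disjoint_left.2 fun x hx hx' =>
    (Finset.mem_compl.1 hx') (Finset.mem_union_left _ hx)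
  have h23 : Disjoint A₂ A₃ := Finset.disjoint_left.2 fun x hx hx' =>
    (Finset.mem_compl.1 hx') (Finset.mem_union_right _ hx)
  have hV : onSiteSum U μ (Finset.univ : Finset Λ) =
      onSiteSum U μ A₁ + onSiteSum U μ A₂ + onSiteSum U μ A₃ := by
    rw [← Finset.union_compl (A₁ ∪ A₂), onSiteSum_union U μ disjoint_compl_right, onSiteSum_union U μ hA]
  have d12 := disjoint_orbs hA
  have d13 := disjoint_orbs h13
  have d23 := disjoint_orbs h23
  have mV : ∀ A : Finset Λ, -(β • onSiteSum U μ A) ∈ carEvenSubalgebra (orbs A) := fun A =>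
    Subalgebra.neg_mem _ (Subalgebra.smul_mem _ (onSiteSum_mem U μ subset_rfl) _)
  have m1 : -(β • onSiteSum U μ A₁) + P₁ ∈ carEvenSubalgebra (orbs A₁) := Subalgebra.add_mem _ (mV A₁) hP₁
  have m2 : -(β • onSiteSum U μ A₂) + P₂ ∈ carEvenSubalgebra (orbs A₂) := Subalgebra.add_mem _ (mV A₂) hP₂
  have key : ∀ Q₁ Q₂ : Matrix (Finset (Orb Λ)) (Finset (Orb Λ)) ℂ, Q₁ ∈ carEvenSubalgebra (orbs A₁) →
      Q₂ ∈ carEvenSubalgebra (orbs A₂) →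
      (NormedSpace.exp (Q₁ + Q₂ + -(β • onSiteSum U μ A₃))).trace * (2 ^ Fintype.card (Orb Λ)) ^ 2 =
        (NormedSpace.exp Q₁).trace * (NormedSpace.exp Q₂).trace *
          (NormedSpace.exp (-(β • onSiteSum U μ A₃))).trace :=
    fun Q₁ Q₂ h₁ h₂ => trace_exp_add_add_mul h₁ h₂ (mV A₃) d12 d13 d23
  have e12 : -(β • onSiteSum U μ (Finset.univ : Finset Λ)) + P₁ + P₂ =
      (-(β • onSiteSum U μ A₁) + P₁) + (-(β • onSiteSum U μ A₂) + P₂) + -(β • onSiteSum U μ A₃) := by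
    rw [hV]; simp only [smul_add, neg_add]; abel
  have e0 : -(β • onSiteSum U μ (Finset.univ : Finset Λ)) =
      -(β • onSiteSum U μ A₁) + -(β • onSiteSum U μ A₂) + -(β • onSiteSum U μ A₃) := by
    rw [hV]; simp only [smul_add, neg_add]
  have e1 : -(β • onSiteSum U μ (Finset.univ : Finset Λ)) + P₁ =
      (-(β • onSiteSum U μ A₁) + P₁) + -(β • onSiteSum U μ A₂) + -(β • onSiteSum U μ A₃) := by
    rw [hV]; simp only [smul_add, neg_add]; abel
  have e2 : -(β • onSiteSum U μ (Finset.univ : Finset Λ)) + P₂ =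
      -(β • onSiteSum U μ A₁) + (-(β • onSiteSum U μ A₂) + P₂) + -(β • onSiteSum U μ A₃) := by
    rw [hV]; simp only [smul_add, neg_add]; abel
  rw [e12, e1, e2, e0]
  exact twR_cross_mul_aux (pow_ne_zero _ (pow_ne_zero _ two_ne_zero)) (key _ _ m1 m2) (key _ _ (mV A₁) (mV A₂))
    (key _ _ m1 (mV A₂)) (key _ _ (mV A₁) m2)

end Factorisation

/-! ### Volume independence along order embeddings -/

section Embedding

variable {Λ Λ' : Type*} [LinearOrder Λ] [Fintype Λ] [LinearOrder Λ'] [Fintype Λ']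

/-- **Isotony of the even subalgebras under second quantisation**: `jwEmbed (orbEmb e)` maps the even CAR
subalgebra of the orbital set `S` into the even CAR subalgebra of its image. [folklore] -/
theorem twR_jwEmbed_mem_carEvenSubalgebra (e : Λ ↪o Λ') {S : Finset (Orb Λ)} {T : Finset (Orb Λ')}
    (hST : ∀ i ∈ S, orbEmb e i ∈ T) {P : Matrix (Finset (Orb Λ)) (Finset (Orb Λ)) ℂ}
    (hP : P ∈ carEvenSubalgebra S) : jwEmbed (orbEmb e) P ∈ carEvenSubalgebra T := by
  have hle : Subalgebra.map (jwEmbed (orbEmb e)) (carEvenSubalgebra S) ≤ carEvenSubalgebra T := by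
    rw [carEvenSubalgebra, AlgHom.map_adjoin]
    refine Algebra.adjoin_le ?_
    rintro _ ⟨M, ⟨l, l', hl, hl', rfl⟩, rfl⟩
    refine Algebra.subset_adjoin ⟨(orbEmb e l.1, l.2), (orbEmb e l'.1, l'.2), hST _ hl, hST _ hl', ?_⟩
    rw [map_mul]
    congr 1
    · rcases l with ⟨i, b⟩
      cases b <;> simp [letterOp]
    · rcases l' with ⟨i, b⟩
      cases b <;> simp [letterOp]
  exact hle ⟨P, hP, rfl⟩

omit [Fintype Λ'] in
/-- The image of all orbitals of `Λ` lies in the orbitals of the image site set. [folklore] -/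
theorem twR_orbEmb_mem_orbs_map (e : Λ ↪o Λ') (i : Orb Λ) :
    orbEmb e i ∈ orbs ((Finset.univ : Finset Λ).map e.toEmbedding) := by
  have : orbEmb e i = orb (e (ofLex i).1) (ofLex i).2 := rfl
  rw [this]
  exact orb_mem_orbs.2 (Finset.mem_map.2 ⟨(ofLex i).1, Finset.mem_univ _, rfl⟩)

/-- The number of orbitals is twice the number of sites. [folklore] -/
theorem twR_card_orb_eq (Λ : Type*) [Fintype Λ] : Fintype.card (Orb Λ) = 2 * Fintype.card Λ := by
  simp [Orb, Lex, Fintype.card_prod, mul_comm]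

/-- **Volume independence of the atomic Gibbs factor with an abstract even perturbation**: along an order
embedding of site sets `e : Λ ↪o Λ'`, for every even operator `P` of `Λ`,
`Tr_{Λ'} exp(-β V_{Λ'} + jwEmbed e P) = Tr_Λ exp(-β V_Λ + P) · z₀^{|Λ'| - |Λ|}` — the extra sites
contribute their atomic factor. [folklore] -/
theorem twR_trace_exp_atomic_add_jwEmbed (e : Λ ↪o Λ') (β U μ : ℂ)
    {P : Matrix (Finset (Orb Λ)) (Finset (Orb Λ)) ℂ}
    (hP : P ∈ carEvenSubalgebra (orbs (Finset.univ : Finset Λ))) :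
    (NormedSpace.exp (-(β • onSiteSum U μ (Finset.univ : Finset Λ')) + jwEmbed (orbEmb e) P)).trace =
      (NormedSpace.exp (-(β • onSiteSum U μ (Finset.univ : Finset Λ)) + P)).trace *
        atomicPartitionFn β U μ ^ (Fintype.card Λ' - Fintype.card Λ) := by
  set R : Finset Λ' := (Finset.univ : Finset Λ).map e.toEmbedding with hR
  have hRc : Rᶜ.card = Fintype.card Λ' - Fintype.card Λ := by
    rw [Finset.card_compl, hR, Finset.card_map, Finset.card_univ]
  have hle : Fintype.card Λ ≤ Fintype.card Λ' := Fintype.card_le_of_embedding e.toEmbedding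
  have hV : onSiteSum U μ (Finset.univ : Finset Λ') = onSiteSum U μ R + onSiteSum U μ Rᶜ := by
    rw [← Finset.union_compl R, onSiteSum_union U μ disjoint_compl_right]
  set X₁ := -(β • onSiteSum U μ R) + jwEmbed (orbEmb e) P with hX₁
  set X₃ := -(β • onSiteSum U μ Rᶜ) with hX₃
  have hexp : -(β • onSiteSum U μ (Finset.univ : Finset Λ')) + jwEmbed (orbEmb e) P = X₁ + X₃ := by
    rw [hV, smul_add, neg_add, hX₁, hX₃]; abel
  have hX₁e : X₁ = jwEmbed (orbEmb e) (-(β • onSiteSum U μ (Finset.univ : Finset Λ)) + P) := by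
    rw [map_add, map_neg, map_smul, jwEmbed_onSiteSum]
  have mX₁ : X₁ ∈ carEvenSubalgebra (orbs R) :=
    Subalgebra.add_mem _ (Subalgebra.neg_mem _ (Subalgebra.smul_mem _ (onSiteSum_mem U μ subset_rfl) _))
      (twR_jwEmbed_mem_carEvenSubalgebra e (fun i _ => twR_orbEmb_mem_orbs_map e i) hP)
  have mX₃ : X₃ ∈ carEvenSubalgebra (orbs Rᶜ) :=
    Subalgebra.neg_mem _ (Subalgebra.smul_mem _ (onSiteSum_mem U μ subset_rfl) _)
  have hd : Disjoint (orbs R) (orbs Rᶜ) := disjoint_orbs disjoint_compl_right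
  have hcomm : Commute X₁ X₃ :=
    commute_of_mem_carEvenSubalgebra mX₁ (carEvenSubalgebra_le_carSubalgebra _ mX₃) hd
  have hfac := trace_mul_of_mem_carSubalgebra
    (exp_mem_subalgebra _ (carEvenSubalgebra_le_carSubalgebra _ mX₁))
    (exp_mem_subalgebra _ (carEvenSubalgebra_le_carSubalgebra _ mX₃)) hd
  rw [← Matrix.exp_add_of_commute _ _ hcomm] at hfac
  have h1 : (NormedSpace.exp X₁).trace = 2 ^ (Fintype.card (Orb Λ') - Fintype.card (Orb Λ)) *
      (NormedSpace.exp (-(β • onSiteSum U μ (Finset.univ : Finset Λ)) + P)).trace := by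
    rw [hX₁e, trace_exp_jwEmbed]
  have h3 : (NormedSpace.exp X₃).trace =
      atomicPartitionFn β U μ ^ (Fintype.card Λ' - Fintype.card Λ) * 4 ^ Fintype.card Λ := by
    rw [hX₃, trace_exp_neg_onSiteSum, hRc]
    congr 2
    omega
  rw [hexp]
  have h2pow : (2 : ℂ) ^ Fintype.card (Orb Λ') = 4 ^ Fintype.card Λ' := by
    rw [twR_card_orb_eq, pow_mul]; norm_num
  have h2pow' : (2 : ℂ) ^ (Fintype.card (Orb Λ') - Fintype.card (Orb Λ)) = 4 ^ (Fintype.card Λ' - Fintype.card Λ) := by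
    rw [twR_card_orb_eq, twR_card_orb_eq, ← Nat.mul_sub, pow_mul]; norm_num
  have h4 : (4 : ℂ) ^ Fintype.card Λ' ≠ 0 := pow_ne_zero _ (by norm_num)
  have hsplit : (4 : ℂ) ^ Fintype.card Λ' = 4 ^ (Fintype.card Λ' - Fintype.card Λ) * 4 ^ Fintype.card Λ := by
    rw [← pow_add, Nat.sub_add_cancel hle]
  set Z := (NormedSpace.exp (-(β • onSiteSum U μ (Finset.univ : Finset Λ)) + P)).trace with hZ
  have main : (NormedSpace.exp (X₁ + X₃)).trace * 4 ^ Fintype.card Λ' =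
      Z * atomicPartitionFn β U μ ^ (Fintype.card Λ' - Fintype.card Λ) * 4 ^ Fintype.card Λ' :=
    calc (NormedSpace.exp (X₁ + X₃)).trace * 4 ^ Fintype.card Λ'
        = (NormedSpace.exp (X₁ + X₃)).trace * 2 ^ Fintype.card (Orb Λ') := by rw [h2pow]
      _ = (NormedSpace.exp X₁).trace * (NormedSpace.exp X₃).trace := hfac
      _ = (2 ^ (Fintype.card (Orb Λ') - Fintype.card (Orb Λ)) * Z) *
            (atomicPartitionFn β U μ ^ (Fintype.card Λ' - Fintype.card Λ) * 4 ^ Fintype.card Λ) := by rw [h1, h3]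
      _ = (4 ^ (Fintype.card Λ' - Fintype.card Λ) * Z) *
            (atomicPartitionFn β U μ ^ (Fintype.card Λ' - Fintype.card Λ) * 4 ^ Fintype.card Λ) := by rw [h2pow']
      _ = Z * atomicPartitionFn β U μ ^ (Fintype.card Λ' - Fintype.card Λ) *
            (4 ^ (Fintype.card Λ' - Fintype.card Λ) * 4 ^ Fintype.card Λ) := by ring
      _ = Z * atomicPartitionFn β U μ ^ (Fintype.card Λ' - Fintype.card Λ) * 4 ^ Fintype.card Λ' := by
            rw [← hsplit]
  exact mul_right_cancel₀ h4 main

end Embedding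

/-! ### Summary (registered sub-goal of stmt-HubbardSuperconductivity-15581) -/

/-- **Registered sub-goal `twR_gibbsFactorisation`** (infrastructure for `stub_sourcedPressureLimit`): the
factorisation over disjoint supports and the volume independence of the atomic Gibbs factor with an
arbitrary even local perturbation, for site types in `Type`. [folklore] -/
theorem twR_gibbsFactorisation : (∀ (Λ : Type) [LinearOrder Λ] [Fintype Λ] (β U μ : ℂ) (A₁ A₂ : Finset Λ), Disjoint A₁ A₂ → ∀ (P₁ P₂ : Matrix (Finset (Orb Λ)) (Finset (Orb Λ)) ℂ), P₁ ∈ carEvenSubalgebra (orbs A₁) → P₂ ∈ carEvenSubalgebra (orbs A₂) → (NormedSpace.exp (-(β • onSiteSum U μ (Finset.univ : Finset Λ)) + P₁ + P₂)).trace * (NormedSpace.exp (-(β • onSiteSum U μ (Finset.univ : Finset Λ)))).trace = (NormedSpace.exp (-(β • onSiteSum U μ (Finset.univ : Finset Λ)) + P₁)).trace * (NormedSpace.exp (-(β • onSiteSum U μ (Finset.univ : Finset Λ)) + P₂)).trace) ∧ (∀ (Λ Λ' : Type) [LinearOrder Λ] [Fintype Λ] [LinearOrder Λ'] [Fintype Λ']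 (e : Λ ↪o Λ') (β U μ : ℂ) (P : Matrix (Finset (Orb Λ)) (Finset (Orb Λ)) ℂ), P ∈ carEvenSubalgebra (orbs (Finset.univ : Finset Λ)) → (NormedSpace.exp (-(β • onSiteSum U μ (Finset.univ : Finset Λ')) + jwEmbed (orbEmb e) P)).trace = (NormedSpace.exp (-(β • onSiteSum U μ (Finset.univ : Finset Λ)) + P)).trace * atomicPartitionFn β U μ ^ (Fintype.card Λ' - Fintype.card Λ)) :=
  ⟨fun _ _ _ β U μ _ _ hA _ _ hP₁ hP₂ => twR_trace_exp_atomic_add_add_mul β U μ hA hP₁ hP₂,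
    fun _ _ _ _ _ _ e β U μ _ hP => twR_trace_exp_atomic_add_jwEmbed e β U μ hP⟩

end Summit.HubbardSuperconductivity.HubbardSuperconductivity.Theorems

end
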